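import Summits.KontsevichZagierPeriods.KontsevichZagierPeriods.Theorems.BetaCancellation.Negative.KernelForm

/-!
# `BetaCancellation` (stmt-KontsevichZagierPeriods-13633) — the stubs of line `dirichlet-companion-to-pi` are summit-implied

drefute (refuter) calibration of the reduction skeleton `dirichlet-companion-to-pi` of crux #4
of route TerasomaMultiplication (skeleton a39148ca83c8; the lead's PICKED line).  Its two explicit
stubs are closed-form identities between Mellin-type box representations:

* `stub_companionCollapse` — `[(0,1)², x^{ℓ+m-1}(1-x)^{-m} · y^{ℓ-1}(1-y)^{m-1}] ∼ [(0,1), ℓ⁻¹ y^{m-1}(1-y)^{-m}]`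
  (Dirichlet re-association of `β(ℓ+m,1-m) ⊗ β(ℓ,m)` onto the reflection class `ℓ⁻¹ β(m,1-m)`);
* `stub_betaTranslation` — `[(0,1), (a+b) x^{a-1}(1-x)^{b}] ∼ [(0,1), b x^{a-1}(1-x)^{b-1}]`.

Findings, all sorry-free with axioms ⊆ {propext, Classical.choice, Quot.sound}:

* §1 `setIntegral_pinDomain` — Fubini on the pinned shape for ANY set/function pair
  (generalises `value_of_isPinned`), `setIntegral_coord0`, `box_eq_pinDomain`.
* §2 exact values: `value_P = B(ℓ+m,1-m)·B(ℓ,m)`, `value_R = ℓ⁻¹·B(m,1-m)`,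
  `value_rho = (a+b)·B(a,b+1)`, `value_rho' = b·B(a,b)` (`B = ProbabilityTheory.beta`), and the
  Γ-telescoping identities `beta_companion_identity`, `beta_translation_identity`.
* §3 IRREFUTABILITY: `stubCompanionCollapse_of_summit`, `stubBetaTranslation_of_summit` — both stubs
  follow from `KontsevichZagierPeriods` (via `KZKernelConjecture`), so a stub-false finding would be
  a disproof of the summit; they are provable-now targets (one Dirichlet chain; one Newton–Leibniz
  move with primitive `x^a (1-x)^b`), not attack surfaces.
* §5 RESHAPED SKELETON (lead, 02:03Z: `stub_companionCollapse` split into `stub_dirichletPolar`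
  `P ∼ S`, `stub_dirichletLinear` `S ∼ B`, `stub_integrateOut` `B ∼ R`): `value_B = B(m,1-m)·B(ℓ,1)`,
  `beta_one_right`, `stubIntegrateOut_of_summit`, and the value-level composite `value_P_eq_value_B`.
* (companion file `DirichletCompanionCharts.lean`: exact pullback identities and inverses of the two
  rule-(2) charts of `stub_dirichletPolar` / `stub_dirichletLinear`.)
* §4 SHARPNESS: `stubBetaTranslationWeak_false` — with `0 < b` weakened to `0 ≤ b` the translation
  stub FAILS at `(a,b) = (1,0)` (`[(0,1),1] ≁ [(0,1),0]`): the guard `0 < b` is load-bearing (it is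
  the vanishing of the boundary term `F(1) = 0^b`); every other guard of the two stubs only excludes
  non-integrable integrands (vacuous instances), as for the crux itself (`LoadBearing.lean` §3).

References: Kontsevich–Zagier 2001 §1.2; Andrews–Askey–Roy 1999, Thm 1.8.1 (Dirichlet);
this project's `KZCalculus.lean`, `Negative/KernelForm.lean`.
-/

noncomputable section

set_option linter.dupNamespace false

namespace Summit.KontsevichZagierPeriods.KontsevichZagierPeriods.BetaCancellationNegative

open MeasureTheory Set
open Literature.NumberTheory.Transcendental
open Literature.NumberTheory.Transcendental.KZ
open Literature.NumberTheory.Transcendental.KZreg (unitIoo)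

/-! ## §1 Fubini on the pinned shape -/

/-- Transfer of a set integral over `{x : ℝ¹ | x₀ ∈ (0,1)}` to `(0,1) ⊆ ℝ`. [folklore] -/
theorem setIntegral_coord0 (f : ℝ → ℝ) :
    ∫ x in {x : Fin 1 → ℝ | x 0 ∈ Ioo (0:ℝ) 1}, f (x 0) = ∫ t in Ioo (0:ℝ) 1, f t := by
  have h1 := (volume_preserving_funUnique (Fin 1) ℝ).setIntegral_preimage_emb
    (MeasurableEquiv.funUnique (Fin 1) ℝ).measurableEmbedding f (Ioo (0:ℝ) 1)
  rw [← h1]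
  rfl

/-- **Fubini on the pinned shape** `(0,1) × σ` with integrand `k ⊗ f`, for an arbitrary set `σ` and
function `f` (Bochner conventions: no integrability needed). [folklore] -/
theorem setIntegral_pinDomain {n : ℕ} (k : ℝ → ℝ) (σ : Set (Fin n → ℝ)) (f : (Fin n → ℝ) → ℝ) :
    ∫ z in pinDomain σ, pinFun k f z = (∫ t in Ioo (0:ℝ) 1, k t) * ∫ x in σ, f x := by
  rw [← (volume_preserving_appendMeasurableEquiv (n := 1) (m := n)).setIntegral_preimage_emb
    (appendMeasurableEquiv 1 n).measurableEmbedding]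
  have hpre : appendMeasurableEquiv 1 n ⁻¹' pinDomain σ =
      {x : Fin 1 → ℝ | x 0 ∈ Ioo (0:ℝ) 1} ×ˢ σ := by
    ext p
    simp only [mem_preimage, appendMeasurableEquiv_apply, pinDomain, mem_setOf_eq,
      Fin.append_left, Fin.append_right, mem_prod]
  have hfun : ∀ p : (Fin 1 → ℝ) × (Fin n → ℝ),
      pinFun k f (appendMeasurableEquiv 1 n p) = k (p.1 0) * f p.2 := by
    intro p
    simp only [appendMeasurableEquiv_apply, pinFun, Fin.append_left, Fin.append_right]
  simp_rw [hfun]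
  rw [hpre, Measure.volume_eq_prod,
    setIntegral_prod_mul (fun x : Fin 1 → ℝ => k (x 0)) f]
  congr 1
  exact setIntegral_coord0 k

/-- The open box `(0,1)²` in the stub's coordinates is the pinned domain over `(0,1)`. [folklore] -/
theorem box_eq_pinDomain :
    {z : Fin 2 → ℝ | z 0 ∈ Set.Ioo (0:ℝ) 1 ∧ z 1 ∈ Set.Ioo (0:ℝ) 1} =
      pinDomain (n := 1) {x : Fin 1 → ℝ | x 0 ∈ Ioo (0:ℝ) 1} := by
  ext z
  simp only [pinDomain, mem_setOf_eq]
  rfl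

/-- The Beta integral with the stubs' literal exponents. [folklore] -/
theorem integral_kernel_eq_beta {a b : ℚ} (ha : 0 < a) (hb : 0 < b) :
    ∫ t in Ioo (0:ℝ) 1, t ^ ((a:ℝ) - 1) * (1 - t) ^ ((b:ℝ) - 1) = ProbabilityTheory.beta a b :=
  (integrableOn_betaKernel_and_integral_eq ha hb).2

/-! ## §2 Exact values -/

/-- Value of the companion pair `P`: `B(ℓ+m,1-m)·B(ℓ,m)`. [folklore] -/
theorem value_P {ℓ m : ℚ} (hℓ : 0 < ℓ) (hm : 0 < m) (hm1 : m < 1) (P : IntegralRep 2)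
    (hPd : P.domain = {z | z 0 ∈ Set.Ioo (0:ℝ) 1 ∧ z 1 ∈ Set.Ioo (0:ℝ) 1})
    (hPi : Set.EqOn P.integrand (fun z => (z 0) ^ ((ℓ:ℝ) + m - 1) * (1 - z 0) ^ (-(m:ℝ)) *
      ((z 1) ^ ((ℓ:ℝ) - 1) * (1 - z 1) ^ ((m:ℝ) - 1))) P.domain) :
    P.value = ProbabilityTheory.beta ((ℓ:ℝ) + m) (1 - m) * ProbabilityTheory.beta ℓ m := by
  have hmeas : MeasurableSet P.domain := IntegralRep.measurableSet_domain_holds P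
  rw [IntegralRep.value, setIntegral_congr_fun hmeas hPi, hPd, box_eq_pinDomain]
  have h := setIntegral_pinDomain (n := 1) (fun t => t ^ ((ℓ:ℝ) + m - 1) * (1 - t) ^ (-(m:ℝ)))
    {x : Fin 1 → ℝ | x 0 ∈ Ioo (0:ℝ) 1} (fun x => (x 0) ^ ((ℓ:ℝ) - 1) * (1 - x 0) ^ ((m:ℝ) - 1))
  have hfun : (pinFun (n := 1) (fun t => t ^ ((ℓ:ℝ) + m - 1) * (1 - t) ^ (-(m:ℝ)))
      (fun x => (x 0) ^ ((ℓ:ℝ) - 1) * (1 - x 0) ^ ((m:ℝ) - 1))) =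
      fun z => (z 0) ^ ((ℓ:ℝ) + m - 1) * (1 - z 0) ^ (-(m:ℝ)) *
        ((z 1) ^ ((ℓ:ℝ) - 1) * (1 - z 1) ^ ((m:ℝ) - 1)) := by
    funext z
    simp only [pinFun]
    rfl
  rw [hfun] at h
  rw [h, setIntegral_coord0 (fun t => t ^ ((ℓ:ℝ) - 1) * (1 - t) ^ ((m:ℝ) - 1)),
    integral_kernel_eq_beta hℓ hm]
  have h1 : ∫ t in Ioo (0:ℝ) 1, t ^ ((ℓ:ℝ) + m - 1) * (1 - t) ^ (-(m:ℝ)) =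
      ProbabilityTheory.beta ((ℓ:ℝ) + m) (1 - m) := by
    have hlm : 0 < ℓ + m := by linarith
    have h1m : 0 < 1 - m := by linarith
    have := integral_kernel_eq_beta hlm h1m
    push_cast at this
    have e : (1:ℝ) - m - 1 = -(m:ℝ) := by ring
    rw [e] at this
    exact this
  rw [h1]

/-- Value of the collapsed representation `R`: `ℓ⁻¹·B(m,1-m)`. [folklore] -/
theorem value_R {ℓ m : ℚ} (hm : 0 < m) (hm1 : m < 1) (R : IntegralRep 1)
    (hRd : R.domain = {x | x 0 ∈ Set.Ioo (0:ℝ) 1})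
    (hRi : Set.EqOn R.integrand (fun x => (ℓ:ℝ)⁻¹ * ((x 0) ^ ((m:ℝ) - 1) * (1 - x 0) ^ (-(m:ℝ)))) R.domain) :
    R.value = (ℓ:ℝ)⁻¹ * ProbabilityTheory.beta (m:ℝ) (1 - m) := by
  have hmeas : MeasurableSet R.domain := IntegralRep.measurableSet_domain_holds R
  rw [IntegralRep.value, setIntegral_congr_fun hmeas hRi, hRd,
    setIntegral_coord0 (fun t => (ℓ:ℝ)⁻¹ * (t ^ ((m:ℝ) - 1) * (1 - t) ^ (-(m:ℝ)))),
    integral_const_mul]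
  congr 1
  have h1m : 0 < 1 - m := by linarith
  have := integral_kernel_eq_beta hm h1m
  push_cast at this
  have e : (1:ℝ) - m - 1 = -(m:ℝ) := by ring
  rw [e] at this
  exact this

/-- Value of `ρ`: `(a+b)·B(a,b+1)`. [folklore] -/
theorem value_rho {a b : ℚ} (ha : 0 < a) (hb : 0 < b) (ρ : IntegralRep 1)
    (hd : ρ.domain = {x | x 0 ∈ Set.Ioo (0:ℝ) 1})
    (hi : Set.EqOn ρ.integrand (fun x => ((a:ℝ) + b) * ((x 0) ^ ((a:ℝ) - 1) * (1 - x 0) ^ (b:ℝ))) ρ.domain) :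
    ρ.value = ((a:ℝ) + b) * ProbabilityTheory.beta (a:ℝ) (b + 1) := by
  have hmeas : MeasurableSet ρ.domain := IntegralRep.measurableSet_domain_holds ρ
  rw [IntegralRep.value, setIntegral_congr_fun hmeas hi, hd,
    setIntegral_coord0 (fun t => ((a:ℝ) + b) * (t ^ ((a:ℝ) - 1) * (1 - t) ^ (b:ℝ))),
    integral_const_mul]
  congr 1
  have hb1 : 0 < b + 1 := by linarith
  have := integral_kernel_eq_beta ha hb1
  push_cast at this
  have e : (b:ℝ) + 1 - 1 = (b:ℝ) := by ring
  rw [e] at this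
  exact this

/-- Value of `ρ'`: `b·B(a,b)`. [folklore] -/
theorem value_rho' {a b : ℚ} (ha : 0 < a) (hb : 0 < b) (ρ' : IntegralRep 1)
    (hd : ρ'.domain = {x | x 0 ∈ Set.Ioo (0:ℝ) 1})
    (hi : Set.EqOn ρ'.integrand (fun x => (b:ℝ) * ((x 0) ^ ((a:ℝ) - 1) * (1 - x 0) ^ ((b:ℝ) - 1))) ρ'.domain) :
    ρ'.value = (b:ℝ) * ProbabilityTheory.beta (a:ℝ) b := by
  have hmeas : MeasurableSet ρ'.domain := IntegralRep.measurableSet_domain_holds ρ'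
  rw [IntegralRep.value, setIntegral_congr_fun hmeas hi, hd,
    setIntegral_coord0 (fun t => (b:ℝ) * (t ^ ((a:ℝ) - 1) * (1 - t) ^ ((b:ℝ) - 1))),
    integral_const_mul, integral_kernel_eq_beta ha hb]

/-- Γ-telescoping behind the companion collapse: `B(ℓ+m,1-m)·B(ℓ,m) = ℓ⁻¹·B(m,1-m)`
(`Γ(ℓ+1) = ℓΓ(ℓ)`, `Γ(1) = 1`). [folklore] -/
theorem beta_companion_identity {ℓ m : ℝ} (hℓ : 0 < ℓ) (hm : 0 < m) :
    ProbabilityTheory.beta (ℓ + m) (1 - m) * ProbabilityTheory.beta ℓ m =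
      ℓ⁻¹ * ProbabilityTheory.beta m (1 - m) := by
  simp only [ProbabilityTheory.beta]
  have e1 : ℓ + m + (1 - m) = ℓ + 1 := by ring
  have e2 : m + (1 - m) = 1 := by ring
  rw [e1, e2, Real.Gamma_add_one hℓ.ne', Real.Gamma_one]
  have hG1 : Real.Gamma ℓ ≠ 0 := (Real.Gamma_pos_of_pos hℓ).ne'
  have hG2 : Real.Gamma (ℓ + m) ≠ 0 := (Real.Gamma_pos_of_pos (by linarith)).ne'
  field_simp

/-- `(a+b)·B(a,b+1) = b·B(a,b)` (`Γ(b+1) = bΓ(b)`, `Γ(a+b+1) = (a+b)Γ(a+b)`). [folklore] -/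
theorem beta_translation_identity {a b : ℝ} (ha : 0 < a) (hb : 0 < b) :
    (a + b) * ProbabilityTheory.beta a (b + 1) = b * ProbabilityTheory.beta a b := by
  simp only [ProbabilityTheory.beta]
  have e1 : a + (b + 1) = (a + b) + 1 := by ring
  rw [e1, Real.Gamma_add_one hb.ne', Real.Gamma_add_one (by linarith : a + b ≠ 0)]
  have hG : Real.Gamma (a + b) ≠ 0 := (Real.Gamma_pos_of_pos (by linarith)).ne'
  have hab : a + b ≠ 0 := by linarith
  field_simp

/-! ## §3 The stubs are summit-implied -/

/-- Kernel conjecture ⇒ `stub_companionCollapse` (verbatim signature of skeleton a39148ca83c8). [folklore] -/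
theorem stubCompanionCollapse_of_kernel (hK : KZKernelConjecture) :
    ∀ (ℓ m : ℚ), 0 < ℓ → 0 < m → m < 1 → ∀ (P : Literature.NumberTheory.Transcendental.KZ.IntegralRep 2) (R : Literature.NumberTheory.Transcendental.KZ.IntegralRep 1), P.domain = {z | z 0 ∈ Set.Ioo (0:ℝ) 1 ∧ z 1 ∈ Set.Ioo (0:ℝ) 1} → Set.EqOn P.integrand (fun z => (z 0) ^ ((ℓ:ℝ) + m - 1) * (1 - z 0) ^ (-(m:ℝ)) * ((z 1) ^ ((ℓ:ℝ) - 1) * (1 - z 1) ^ ((m:ℝ) - 1))) P.domain → R.domain = {x | x 0 ∈ Set.Ioo (0:ℝ) 1} → Set.EqOn R.integrand (fun x => (ℓ:ℝ)⁻¹ * ((x 0) ^ ((m:ℝ) - 1) * (1 - x 0) ^ (-(m:ℝ)))) R.domain → Literature.NumberTheory.Transcendental.KZ.Equivalent P R := by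
  intro ℓ m hℓ hm hm1 P R hPd hPi hRd hRi
  apply hK
  rw [KZ.eval_of_sub_of, value_P hℓ hm hm1 P hPd hPi, value_R hm hm1 R hRd hRi, sub_eq_zero]
  exact beta_companion_identity (by exact_mod_cast hℓ) (by exact_mod_cast hm)

/-- Kernel conjecture ⇒ `stub_betaTranslation` (verbatim signature of skeleton a39148ca83c8). [folklore] -/
theorem stubBetaTranslation_of_kernel (hK : KZKernelConjecture) :
    ∀ (a b : ℚ), 0 < a → 0 < b → ∀ (ρ ρ' : Literature.NumberTheory.Transcendental.KZ.IntegralRep 1), ρ.domain = {x | x 0 ∈ Set.Ioo (0:ℝ) 1} → Set.EqOn ρ.integrand (fun x => ((a:ℝ) + b) * ((x 0) ^ ((a:ℝ) - 1) * (1 - x 0) ^ (b:ℝ))) ρ.domain → ρ'.domain = {x | x 0 ∈ Set.Ioo (0:ℝ) 1} → Set.EqOn ρ'.integrand (fun x => (b:ℝ) * ((x 0) ^ ((a:ℝ) - 1) * (1 - x 0) ^ ((b:ℝ) - 1))) ρ'.domain → Literature.NumberTheory.Transcendental.KZ.Equivalent ρ ρ' := by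
  intro a b ha hb ρ ρ' hd hi hd' hi'
  apply hK
  rw [KZ.eval_of_sub_of, value_rho ha hb ρ hd hi, value_rho' ha hb ρ' hd' hi', sub_eq_zero]
  exact beta_translation_identity (by exact_mod_cast ha) (by exact_mod_cast hb)

/-- **Summit ⇒ `stub_companionCollapse`**: the stub is irrefutable short of refuting the summit. [folklore] -/
theorem stubCompanionCollapse_of_summit (h : _root_.KontsevichZagierPeriods) :
    ∀ (ℓ m : ℚ), 0 < ℓ → 0 < m → m < 1 → ∀ (P : Literature.NumberTheory.Transcendental.KZ.IntegralRep 2) (R : Literature.NumberTheory.Transcendental.KZ.IntegralRep 1), P.domain = {z | z 0 ∈ Set.Ioo (0:ℝ) 1 ∧ z 1 ∈ Set.Ioo (0:ℝ) 1} → Set.EqOn P.integrand (fun z => (z 0) ^ ((ℓ:ℝ) + m - 1) * (1 - z 0) ^ (-(m:ℝ)) * ((z 1) ^ ((ℓ:ℝ) - 1) * (1 - z 1) ^ ((m:ℝ) - 1))) P.domain → R.domain = {x | x 0 ∈ Set.Ioo (0:ℝ) 1} → Set.EqOn R.integrand (fun x => (ℓ:ℝ)⁻¹ * ((x 0) ^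 ((m:ℝ) - 1) * (1 - x 0) ^ (-(m:ℝ)))) R.domain → Literature.NumberTheory.Transcendental.KZ.Equivalent P R :=
  stubCompanionCollapse_of_kernel (kzKernelConjecture_iff_isRational.2 h)

/-- **Summit ⇒ `stub_betaTranslation`**: irrefutable short of refuting the summit. [folklore] -/
theorem stubBetaTranslation_of_summit (h : _root_.KontsevichZagierPeriods) :
    ∀ (a b : ℚ), 0 < a → 0 < b → ∀ (ρ ρ' : Literature.NumberTheory.Transcendental.KZ.IntegralRep 1), ρ.domain = {x | x 0 ∈ Set.Ioo (0:ℝ) 1} → Set.EqOn ρ.integrand (fun x => ((a:ℝ) + b) * ((x 0) ^ ((a:ℝ) - 1) * (1 - x 0) ^ (b:ℝ))) ρ.domain → ρ'.domain = {x | x 0 ∈ Set.Ioo (0:ℝ) 1} → Set.EqOn ρ'.integrand (fun x => (b:ℝ) * ((x 0) ^ ((a:ℝ) - 1) * (1 - x 0) ^ ((b:ℝ) - 1))) ρ'.domain → Literature.NumberTheory.Transcendental.KZ.Equivalent ρ ρ' :=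
  stubBetaTranslation_of_kernel (kzKernelConjecture_iff_isRational.2 h)


/-! ## §4 Sharpness of the guards (hypothesis mutation)

`stub_betaTranslation` with `0 < b` weakened to `0 ≤ b` is FALSE at `(a, b) = (1, 0)`:
`ρ = [(0,1), 1]` (value `1`) and `ρ' = [(0,1), 0]` (value `0`) satisfy the pins, and equivalent
representations have equal values.  (So a proof must use `0 < b` essentially: it is the vanishing
of the boundary term `F(1) = 0^b` of the primitive `F = x^a (1-x)^b`.)  The other guards of the two
explicit stubs (`0 < a`; `0 < ℓ`, `0 < m`, `m < 1`) only exclude NON-INTEGRABLE integrands, i.e.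
instances with no representation at all (vacuously true), exactly as for the crux (Disproof §7). -/

/-- `[(0,1), 1]` has value `1`. [folklore] -/
theorem value_polyKernelRep_one : (polyKernelRep 1).value = 1 := by
  rw [IntegralRep.value, polyKernelRep_domain, polyKernelRep_integrand]
  have : (fun x : Fin 1 → ℝ => (MvPolynomial.aeval x (1 : MvPolynomial (Fin 1) ℚ) : ℝ)) = fun x => (fun _ : ℝ => (1:ℝ)) (x 0) := by
    funext x; simp
  rw [this, show (unitIoo : Set (Fin 1 → ℝ)) = {x : Fin 1 → ℝ | x 0 ∈ Ioo (0:ℝ) 1} from rfl,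
    setIntegral_coord0 (fun _ => (1:ℝ))]
  simp

/-- `[(0,1), 0]` has value `0`. [folklore] -/
theorem value_polyKernelRep_zero : (polyKernelRep 0).value = 0 := by
  rw [IntegralRep.value, polyKernelRep_integrand]
  simp

/-- **The guard `0 < b` of `stub_betaTranslation` is sharp**: weakened to `0 ≤ b` the stub fails
at `(a,b) = (1,0)` with `ρ = [(0,1),1]`, `ρ' = [(0,1),0]`. [folklore] -/
theorem stubBetaTranslationWeak_false :
    ¬ (∀ (a b : ℚ), 0 < a → 0 ≤ b → ∀ (ρ ρ' : Literature.NumberTheory.Transcendental.KZ.IntegralRep 1), ρ.domain = {x | x 0 ∈ Set.Ioo (0:ℝ) 1} → Set.EqOn ρ.integrand (fun x => ((a:ℝ) + b) * ((x 0) ^ ((a:ℝ) - 1) * (1 - x 0) ^ (b:ℝ))) ρ.domain → ρ'.domain = {x | x 0 ∈ Set.Ioo (0:ℝ) 1} → Set.EqOn ρ'.integrand (fun x => (b:ℝ) * ((x 0) ^ ((a:ℝ) - 1) * (1 - x 0) ^ ((b:ℝ) - 1))) ρ'.domain → Literature.NumberTheory.Transcendental.KZ.Equivalent ρ ρ') :=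 by
  intro h
  have hρ : Set.EqOn (polyKernelRep 1).integrand
      (fun x => (((1:ℚ):ℝ) + ((0:ℚ):ℝ)) * ((x 0) ^ (((1:ℚ):ℝ) - 1) * (1 - x 0) ^ (((0:ℚ)):ℝ)))
      (polyKernelRep 1).domain := by
    intro x _
    simp
  have hρ' : Set.EqOn (polyKernelRep 0).integrand
      (fun x => ((0:ℚ):ℝ) * ((x 0) ^ (((1:ℚ):ℝ) - 1) * (1 - x 0) ^ (((0:ℚ):ℝ) - 1)))
      (polyKernelRep 0).domain := by
    intro x _
    simp
  have heq := h 1 0 one_pos le_rfl (polyKernelRep 1) (polyKernelRep 0) rfl hρ rfl hρ'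
  have hv := Equivalent.value_eq_holds heq
  rw [value_polyKernelRep_one, value_polyKernelRep_zero] at hv
  exact one_ne_zero hv

/-! ## §5 Reshaped skeleton (lead, 2026-08-16T02:03Z): `stub_integrateOut` is summit-implied too

The lead split `stub_companionCollapse` into `stub_dirichletPolar` (P ∼ S, simplex),
`stub_dirichletLinear` (S ∼ B, box) and `stub_integrateOut` (B ∼ R).  `B` is again a pinned box
shape, so its value is certified here: `value_B = B(m,1-m)·B(ℓ,1) = B(m,1-m)/ℓ = value_R`. -/

/-- `B(ℓ,1) = 1/ℓ`. [folklore] -/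
theorem beta_one_right {ℓ : ℝ} (hℓ : 0 < ℓ) : ProbabilityTheory.beta ℓ 1 = ℓ⁻¹ := by
  simp only [ProbabilityTheory.beta]
  rw [Real.Gamma_one, Real.Gamma_add_one hℓ.ne']
  have hG : Real.Gamma ℓ ≠ 0 := (Real.Gamma_pos_of_pos hℓ).ne'
  field_simp

/-- `∫₀¹ t^{ℓ-1} dt = B(ℓ,1)`. [folklore] -/
theorem integral_rpow_eq_beta {ℓ : ℚ} (hℓ : 0 < ℓ) :
    ∫ t in Ioo (0:ℝ) 1, t ^ ((ℓ:ℝ) - 1) = ProbabilityTheory.beta (ℓ:ℝ) 1 := by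
  have h := integral_kernel_eq_beta hℓ one_pos
  push_cast at h
  rw [← h]
  refine setIntegral_congr_fun measurableSet_Ioo fun t _ => ?_
  simp

/-- Value of the box representation `B` of the reshaped skeleton: `B(m,1-m)·B(ℓ,1)`. [folklore] -/
theorem value_B {ℓ m : ℚ} (hℓ : 0 < ℓ) (hm : 0 < m) (hm1 : m < 1) (B : IntegralRep 2)
    (hBd : B.domain = {z | z 0 ∈ Set.Ioo (0:ℝ) 1 ∧ z 1 ∈ Set.Ioo (0:ℝ) 1})
    (hBi : Set.EqOn B.integrand (fun z => (z 0) ^ ((m:ℝ) - 1) * (1 - z 0) ^ (-(m:ℝ)) *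
      (z 1) ^ ((ℓ:ℝ) - 1)) B.domain) :
    B.value = ProbabilityTheory.beta (m:ℝ) (1 - m) * ProbabilityTheory.beta (ℓ:ℝ) 1 := by
  have hmeas : MeasurableSet B.domain := IntegralRep.measurableSet_domain_holds B
  rw [IntegralRep.value, setIntegral_congr_fun hmeas hBi, hBd, box_eq_pinDomain]
  have h := setIntegral_pinDomain (n := 1) (fun t => t ^ ((m:ℝ) - 1) * (1 - t) ^ (-(m:ℝ)))
    {x : Fin 1 → ℝ | x 0 ∈ Ioo (0:ℝ) 1} (fun x => (x 0) ^ ((ℓ:ℝ) - 1))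
  have hfun : (pinFun (n := 1) (fun t => t ^ ((m:ℝ) - 1) * (1 - t) ^ (-(m:ℝ)))
      (fun x => (x 0) ^ ((ℓ:ℝ) - 1))) =
      fun z => (z 0) ^ ((m:ℝ) - 1) * (1 - z 0) ^ (-(m:ℝ)) * (z 1) ^ ((ℓ:ℝ) - 1) := by
    funext z
    simp only [pinFun]
    rfl
  rw [hfun] at h
  rw [h, setIntegral_coord0 (fun t => t ^ ((ℓ:ℝ) - 1)), integral_rpow_eq_beta hℓ]
  have h1m : 0 < 1 - m := by linarith
  have := integral_kernel_eq_beta hm h1m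
  push_cast at this
  have e : (1:ℝ) - m - 1 = -(m:ℝ) := by ring
  rw [e] at this
  rw [this]

/-- Kernel conjecture ⇒ `stub_integrateOut` (verbatim signature, lead's skeleton of 2026-08-16T02:03Z). [folklore] -/
theorem stubIntegrateOut_of_kernel (hK : KZKernelConjecture) :
    ∀ (ℓ m : ℚ), 0 < ℓ → 0 < m → m < 1 → ∀ (B : Literature.NumberTheory.Transcendental.KZ.IntegralRep 2) (R : Literature.NumberTheory.Transcendental.KZ.IntegralRep 1), B.domain = {z | z 0 ∈ Set.Ioo (0:ℝ) 1 ∧ z 1 ∈ Set.Ioo (0:ℝ) 1} → Set.EqOn B.integrand (fun z => (z 0) ^ ((m:ℝ) - 1) * (1 - z 0) ^ (-(m:ℝ)) * (z 1) ^ ((ℓ:ℝ) - 1)) B.domain → R.domain = {x | x 0 ∈ Set.Ioo (0:ℝ) 1} → Set.EqOn R.integrand (fun x => (ℓ:ℝ)⁻¹ * ((x 0) ^ ((m:ℝ) - 1) * (1 - x 0) ^ (-(m:ℝ)))) R.domain → Literature.NumberTheory.Transcendental.KZ.Equivalent B R := by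
  intro ℓ m hℓ hm hm1 B R hBd hBi hRd hRi
  apply hK
  rw [KZ.eval_of_sub_of, value_B hℓ hm hm1 B hBd hBi, value_R hm hm1 R hRd hRi, sub_eq_zero,
    beta_one_right (by exact_mod_cast hℓ : (0:ℝ) < ℓ), mul_comm]

/-- **Summit ⇒ `stub_integrateOut`**: irrefutable short of refuting the summit. [folklore] -/
theorem stubIntegrateOut_of_summit (h : _root_.KontsevichZagierPeriods) :
    ∀ (ℓ m : ℚ), 0 < ℓ → 0 < m → m < 1 → ∀ (B : Literature.NumberTheory.Transcendental.KZ.IntegralRep 2) (R : Literature.NumberTheory.Transcendental.KZ.IntegralRep 1), B.domain = {z | z 0 ∈ Set.Ioo (0:ℝ) 1 ∧ z 1 ∈ Set.Ioo (0:ℝ) 1} → Set.EqOn B.integrand (fun z => (z 0) ^ ((m:ℝ) - 1) * (1 - z 0) ^ (-(m:ℝ)) * (z 1) ^ ((ℓ:ℝ) - 1)) B.domain → R.domain = {x | x 0 ∈ Set.Ioo (0:ℝ) 1} → Set.EqOn R.integrand (fun x => (ℓ:ℝ)⁻¹ * ((x 0) ^ ((m:ℝ) - 1) * (1 - x 0)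 ^ (-(m:ℝ)))) R.domain → Literature.NumberTheory.Transcendental.KZ.Equivalent B R :=
  stubIntegrateOut_of_kernel (kzKernelConjecture_iff_isRational.2 h)

/-- Value-level composite of `stub_dirichletPolar ∘ stub_dirichletLinear`: the companion pair `P`
and the box `B` have the same value, so (summit) `P ∼ B`; the simplex `S` in between has the
classical Dirichlet value `Γ(ℓ)Γ(m)Γ(1-m)/Γ(ℓ+1)` (Andrews–Askey–Roy Thm 1.8.1; checked numerically
to 2e-9 by the drefute seat). [folklore] -/
theorem value_P_eq_value_B {ℓ m : ℚ} (hℓ : 0 < ℓ) (hm : 0 < m) (hm1 : m < 1) (P B : IntegralRep 2)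
    (hPd : P.domain = {z | z 0 ∈ Set.Ioo (0:ℝ) 1 ∧ z 1 ∈ Set.Ioo (0:ℝ) 1})
    (hPi : Set.EqOn P.integrand (fun z => (z 0) ^ ((ℓ:ℝ) + m - 1) * (1 - z 0) ^ (-(m:ℝ)) *
      ((z 1) ^ ((ℓ:ℝ) - 1) * (1 - z 1) ^ ((m:ℝ) - 1))) P.domain)
    (hBd : B.domain = {z | z 0 ∈ Set.Ioo (0:ℝ) 1 ∧ z 1 ∈ Set.Ioo (0:ℝ) 1})
    (hBi : Set.EqOn B.integrand (fun z => (z 0) ^ ((m:ℝ) - 1) * (1 - z 0) ^ (-(m:ℝ)) *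
      (z 1) ^ ((ℓ:ℝ) - 1)) B.domain) :
    P.value = B.value := by
  rw [value_P hℓ hm hm1 P hPd hPi, value_B hℓ hm hm1 B hBd hBi,
    beta_companion_identity (by exact_mod_cast hℓ) (by exact_mod_cast hm),
    beta_one_right (by exact_mod_cast hℓ : (0:ℝ) < ℓ), mul_comm]

end Summit.KontsevichZagierPeriods.KontsevichZagierPeriods.BetaCancellationNegative
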